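import Summits.NavierStokesRegularity.NavierStokesRegularity.Theses.AngularGalerkinLadder
import Summits.NavierStokesRegularity.NavierStokesRegularity.Theorems.NoOverheating.Negative.LadderLimitExposed
import Summits.NavierStokesRegularity.NavierStokesRegularity.Theorems.NoOverheating.Negative.AxisymmetricWindowsExcluded
import Literature.Analysis.FluidPDE.AncientAxisymmetricTypeILiouville
import Literature.Analysis.FluidPDE.PineauVicolAngularMean
import HarnessLib

/-!
# KJ-60 — Window sequences with a discrete rotational symmetry of VANISHING ANGLE are excluded
# (route `AngularGalerkinLadder`, crux K2 `NoOverheating`; refuter lineage, Negative lane)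

Stratum (S21), SEQUENCE-level, aimed at `N`-fold wave patterns (zonal mean + sectoral azimuthal
wave of wave number `N`, invariant under the rotation by `2π/N` about the pattern axis).  If the
`n`-th profile of an admissible window sequence is invariant under conjugation by the rotation of
angle `αₙ ≠ 0` about an axis `Aₙ e₃` (frames `Aₙ` arbitrary) and `αₙ → 0` — e.g. `C_{Nₙ}`-symmetric
patterns with wave numbers `Nₙ → ∞` — then the ladder limit is axisymmetric: the integer multiples
`m αₙ` are `|αₙ|`-dense, so for every angle `θ` the rotations `R_{⌊θ/αₙ⌋ αₙ} → R_θ`, and invariance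
passes to the locally uniform limit
(`isAxisymmetric_conj_of_tendstoLocallyUniformly_of_vanishingAngle`); KNSS 2009 Thm. 5.3 kills
an axisymmetric Type-I ancient mild solution.  Hence

* `no_windowSequence_rotInvariant_vanishingAngle` — (S21): `αₙ → 0`, `αₙ ≠ 0`, exact invariance
  of every slice `uₙ(t, ·)`, `t < 0`, under the rotation by `αₙ` about `Aₙ e₃` ⇒ `False`;
* `no_windowSequence_cyclicSymmetric_unboundedOrder` — `C_{Nₙ}`-symmetric profiles (invariance
  under the rotation by `2π/Nₙ`, `0 < Nₙ`) with `Nₙ → ∞` ⇒ `False`.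

READING FOR THE CIRCUIT: the wave number of an `N`-fold-symmetric K2 supply must stay BOUNDED along
the ladder (pass to a subsequence with constant `N`); a `C_N`-symmetric limit with FIXED `N ≥ 2` is
not excluded by anything in print (no Liouville theorem for discrete rotational symmetry).
Exact axisymmetry (S1) is the case "invariant under every angle".  No equation beyond what the
ladder limit already carries; no `kit`.
[cite: KochNadirashviliSereginSverak2009, Thm. 5.3 and §6 (axisymmetric Type-I Liouville); Lemma 6.1 (limits of rescaled solutions)] -/

namespace Summit.NavierStokesRegularity.AngularGalerkinLadderVanishingAngleSymmetryExcluded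

open Set Filter MeasureTheory Topology Function
open Literature.Analysis Literature.Analysis.FluidPDE
open Summit.NavierStokesRegularity.FluidComputer
open Summit.NavierStokesRegularity.FluidComputer.AngularLadder
open Summit.NavierStokesRegularity.NavierStokesRegularity.Theses.AngularGalerkinLadder
open Summit.NavierStokesRegularity.AngularGalerkinLadderLadderLimit
open Summit.NavierStokesRegularity.AngularGalerkinLadderAxisymmetricWindowsExcluded

/-! ## §1 Kinematics: invariance under one rotation iterates; vanishing angles densify -/

/-- Invariance of a field under conjugation by `R_β` gives invariance under `R_{−β}`. [folklore] -/
theorem rotInvariant_neg {F : EuclideanSpace ℝ (Fin 3) → EuclideanSpace ℝ (Fin 3)} {β : ℝ}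
    (h : ∀ x, F (rotZ β x) = rotZ β (F x)) (x : EuclideanSpace ℝ (Fin 3)) :
    F (rotZ (-β) x) = rotZ (-β) (F x) := by
  have hx : rotZ β (rotZ (-β) x) = x := by rw [← rotZ_add, add_neg_cancel, rotZ_zero]
  have h1 := h (rotZ (-β) x)
  rw [hx] at h1
  rw [h1, ← rotZ_add, neg_add_cancel, rotZ_zero]

/-- Invariance under `R_β` gives invariance under `R_{mβ}`, `m : ℕ`. [folklore] -/
theorem rotInvariant_nat_mul {F : EuclideanSpace ℝ (Fin 3) → EuclideanSpace ℝ (Fin 3)} {β : ℝ}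
    (h : ∀ x, F (rotZ β x) = rotZ β (F x)) (m : ℕ) (x : EuclideanSpace ℝ (Fin 3)) :
    F (rotZ (m * β) x) = rotZ (m * β) (F x) := by
  induction m generalizing x with
  | zero => simp [rotZ_zero]
  | succ k ih =>
    have e : ((k + 1 : ℕ) : ℝ) * β = k * β + β := by push_cast; ring
    rw [e, rotZ_add, ih, h, ← rotZ_add]

/-- Invariance under `R_β` gives invariance under `R_{mβ}`, `m : ℤ`. [folklore] -/
theorem rotInvariant_int_mul {F : EuclideanSpace ℝ (Fin 3) → EuclideanSpace ℝ (Fin 3)} {β : ℝ}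
    (h : ∀ x, F (rotZ β x) = rotZ β (F x)) (m : ℤ) (x : EuclideanSpace ℝ (Fin 3)) :
    F (rotZ (m * β) x) = rotZ (m * β) (F x) := by
  cases m with
  | ofNat k => exact_mod_cast rotInvariant_nat_mul h k x
  | negSucc k =>
    have e : ((Int.negSucc k : ℤ) : ℝ) * β = ((k + 1 : ℕ) : ℝ) * (-β) := by
      rw [Int.cast_negSucc]; push_cast; ring
    rw [e]
    exact rotInvariant_nat_mul (rotInvariant_neg h) (k + 1) x

/-- For `α ≠ 0` the integer multiple `⌊θ/α⌋ α` is within `|α|` of `θ`. [folklore] -/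
theorem abs_floor_mul_sub_le {α : ℝ} (hα : α ≠ 0) (θ : ℝ) :
    |(⌊θ / α⌋ : ℝ) * α - θ| ≤ |α| := by
  have h0 : (⌊θ / α⌋ : ℝ) ≤ θ / α := Int.floor_le _
  have h1 : θ / α < (⌊θ / α⌋ : ℝ) + 1 := Int.lt_floor_add_one _
  have e : (⌊θ / α⌋ : ℝ) * α - θ = ((⌊θ / α⌋ : ℝ) - θ / α) * α := by
    rw [sub_mul, div_mul_cancel₀ θ hα]
  rw [e, abs_mul]
  refine mul_le_of_le_one_left (abs_nonneg α) ?_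
  rw [abs_le]; constructor <;> linarith

/-- Along vanishing nonzero angles `αₙ → 0`, the integer multiples `⌊θ/αₙ⌋ αₙ` converge to `θ`.
[folklore] -/
theorem tendsto_floor_mul {α : ℕ → ℝ} (hα : Tendsto α atTop (𝓝 0)) (hα0 : ∀ n, α n ≠ 0)
    (θ : ℝ) : Tendsto (fun n => (⌊θ / α n⌋ : ℝ) * α n) atTop (𝓝 θ) := by
  rw [tendsto_iff_norm_sub_tendsto_zero]
  have h0 : Tendsto (fun n => |α n|) atTop (𝓝 0) := by simpa using hα.abs
  exact squeeze_zero (fun n => norm_nonneg _) (fun n => abs_floor_mul_sub_le (hα0 n) θ) h0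

/-- Joint continuity of `(θ, y) ↦ R_θ y` along sequences. [folklore] -/
theorem tendsto_rotZ_of_tendsto {ϑ : ℕ → ℝ} {θ : ℝ} {w : ℕ → EuclideanSpace ℝ (Fin 3)}
    {w' : EuclideanSpace ℝ (Fin 3)} (hθ : Tendsto ϑ atTop (𝓝 θ)) (hw : Tendsto w atTop (𝓝 w')) :
    Tendsto (fun n => rotZ (ϑ n) (w n)) atTop (𝓝 (rotZ θ w')) := by
  have h := (continuous_rotZ_uncurry'.tendsto (θ, w')).comp (hθ.prodMk_nhds hw)
  exact h

/-- **Rotational invariance under vanishing angles about MOVING axes passes to locally uniform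
limits as full axisymmetry**: if `Aₙ⁻¹ ∘ fₙ ∘ Aₙ` commutes with `R_{αₙ}`, `αₙ ≠ 0`, `αₙ → 0`,
`Aₙ → A'` pointwise and `fₙ → g` locally uniformly with `g` continuous, then `A'⁻¹ ∘ g ∘ A'` is
axisymmetric. [cite: KochNadirashviliSereginSverak2009, Lemma 6.1 (limits of rescaled solutions)] -/
theorem isAxisymmetric_conj_of_tendstoLocallyUniformly_of_vanishingAngle
    {f : ℕ → EuclideanSpace ℝ (Fin 3) → EuclideanSpace ℝ (Fin 3)}
    {g : EuclideanSpace ℝ (Fin 3) → EuclideanSpace ℝ (Fin 3)}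
    {A : ℕ → (EuclideanSpace ℝ (Fin 3) ≃ₗᵢ[ℝ] EuclideanSpace ℝ (Fin 3))}
    {A' : EuclideanSpace ℝ (Fin 3) ≃ₗᵢ[ℝ] EuclideanSpace ℝ (Fin 3)} {α : ℕ → ℝ}
    (hA : ∀ x, Tendsto (fun n => A n x) atTop (𝓝 (A' x)))
    (hlim : TendstoLocallyUniformly f g atTop) (hg : Continuous g)
    (hα : Tendsto α atTop (𝓝 0)) (hα0 : ∀ n, α n ≠ 0)
    (hinv : ∀ n x, (A n).symm (f n (A n (rotZ (α n) x))) = rotZ (α n) ((A n).symm (f n (A n x)))) :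
    IsAxisymmetric (fun x => A'.symm (g (A' x))) := by
  intro θ x
  -- the approximating angles `ϑₙ = ⌊θ/αₙ⌋ αₙ → θ`
  obtain ⟨ϑ, hϑ⟩ : ∃ ϑ : ℕ → ℝ, ∀ n, ϑ n = (⌊θ / α n⌋ : ℝ) * α n := ⟨_, fun n => rfl⟩
  have hθ : Tendsto ϑ atTop (𝓝 θ) := (tendsto_floor_mul hα hα0 θ).congr fun n => (hϑ n).symm
  -- exact invariance of the `n`-th conjugated field under `R_{ϑₙ}`
  have key : ∀ n, (A n).symm (f n (A n (rotZ (ϑ n) x))) = rotZ (ϑ n) ((A n).symm (f n (A n x))) :=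
    fun n => by
      rw [hϑ n]
      exact rotInvariant_int_mul (F := fun y => (A n).symm (f n (A n y))) (hinv n) ⌊θ / α n⌋ x
  -- the rotated arguments converge: `R_{ϑₙ} x → R_θ x`
  have hy : Tendsto (fun n => rotZ (ϑ n) x) atTop (𝓝 (rotZ θ x)) :=
    tendsto_rotZ_of_tendsto hθ tendsto_const_nhds
  -- left side: `Aₙ⁻¹ fₙ (Aₙ R_{ϑₙ} x) → A'⁻¹ g (A' R_θ x)`
  have hL : Tendsto (fun n => (A n).symm (f n (A n (rotZ (ϑ n) x)))) atTop
      (𝓝 (A'.symm (g (A' (rotZ θ x))))) :=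
    tendsto_linearIsometryEquiv_symm_apply_of_tendsto hA
      (hlim.tendsto_comp hg.continuousAt (tendsto_linearIsometryEquiv_apply_of_tendsto hA hy))
  -- pointwise: `Aₙ⁻¹ fₙ (Aₙ x) → A'⁻¹ g (A' x)`
  have hP : Tendsto (fun n => (A n).symm (f n (A n x))) atTop (𝓝 (A'.symm (g (A' x)))) :=
    tendsto_linearIsometryEquiv_symm_apply_of_tendsto hA
      (hlim.tendsto_comp hg.continuousAt (hA x))
  -- right side: `R_{ϑₙ} Aₙ⁻¹ fₙ (Aₙ x) → R_θ A'⁻¹ g (A' x)` (joint continuity of `(θ, y) ↦ R_θ y`)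
  have hR : Tendsto (fun n => rotZ (ϑ n) ((A n).symm (f n (A n x)))) atTop
      (𝓝 (rotZ θ (A'.symm (g (A' x))))) :=
    tendsto_rotZ_of_tendsto hθ hP
  exact tendsto_nhds_unique hL (hR.congr fun n => (key n).symm)

/-! ## §2 (S21): no admissible window sequence is rotation invariant under vanishing angles -/

variable {C₀ cmin cmax δ : ℝ} {L : ℕ → ℕ} {ε c : ℕ → ℝ}
  {R : ℕ → (EuclideanSpace ℝ (Fin 3) ≃ₗᵢ[ℝ] EuclideanSpace ℝ (Fin 3))}
  {u : ℕ → ℝ → EuclideanSpace ℝ (Fin 3) → EuclideanSpace ℝ (Fin 3)}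
  {p : ℕ → ℝ → EuclideanSpace ℝ (Fin 3) → ℝ}
  {d : ℕ → ℝ → EuclideanSpace ℝ (Fin 3) → EuclideanSpace ℝ (Fin 3)}

/-- **(S21) No admissible window sequence is invariant under rotations of vanishing angle about
moving axes.**  If every slice `uₙ(t, ·)`, `t < 0`, commutes (in the frame `Aₙ`) with the rotation
by `αₙ ≠ 0` about `e₃` and `αₙ → 0`, then along a subsequence the frames converge, the ladder limit
is axisymmetric about the limit axis
(`isAxisymmetric_conj_of_tendstoLocallyUniformly_of_vanishingAngle`) and KNSS 2009 Thm. 5.3 makes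
it vanish — contradicting the inherited window floor.
[cite: KochNadirashviliSereginSverak2009, Thm. 5.3 and §6 (axisymmetric Type-I Liouville); Lemma 6.1 (limits of rescaled solutions)] -/
theorem no_windowSequence_rotInvariant_vanishingAngle (hcmin : 1 < cmin) (hδ : 0 < δ)
    (hε : Tendsto ε atTop (𝓝 0))
    (hW : ∀ n, IsWindowProfile (L n) C₀ cmin cmax δ (ε n) (c n) (R n) (u n) (p n) (d n))
    (A : ℕ → (EuclideanSpace ℝ (Fin 3) ≃ₗᵢ[ℝ] EuclideanSpace ℝ (Fin 3))) (α : ℕ → ℝ)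
    (hα : Tendsto α atTop (𝓝 0)) (hα0 : ∀ n, α n ≠ 0)
    (hinv : ∀ n, ∀ t < 0, ∀ x,
      (A n).symm (u n t (A n (rotZ (α n) x))) = rotZ (α n) ((A n).symm (u n t (A n x)))) :
    False := by
  obtain ⟨ψ, A', hψ, -, hAψ⟩ := exists_subseq_tendsto_linearIsometryEquiv A
  obtain ⟨φ, c', R', v, hφ, -, -, hloc, hvcont, -, hmild, hmeas, -, hTI, hnz⟩ :=
    exists_ladderLimit (L := L ∘ ψ) (ε := ε ∘ ψ) (c := c ∘ ψ) (R := R ∘ ψ) (u := u ∘ ψ)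
      (p := p ∘ ψ) (d := d ∘ ψ) hcmin hδ (hε.comp hψ.tendsto_atTop) (fun n => hW (ψ n))
  have hvax : ∀ t < 0, IsAxisymmetric (fun x => A'.symm (v t (A' x))) := fun t ht =>
    isAxisymmetric_conj_of_tendstoLocallyUniformly_of_vanishingAngle
      (A := fun n => A (ψ (φ n))) (f := fun n => u (ψ (φ n)) t) (α := fun n => α (ψ (φ n)))
      (fun x => (hAψ x).comp hφ.tendsto_atTop) (hloc t ht)
      (continuous_slice_of_continuousOn_Iio hvcont ht)
      (hα.comp (hψ.tendsto_atTop.comp hφ.tendsto_atTop)) (fun n => hα0 _)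
      (fun n x => hinv (ψ (φ n)) t ht x)
  exact hnz (hmild.ae_eq_zero_of_isAxisymmetric_conj_of_hasTypeIDecay hmeas A' hvax hTI)

/-- **(S21), cyclic form: `C_{Nₙ}`-symmetric window sequences need bounded orders.**  If the `n`-th
profile is invariant (in the frame `Aₙ`) under the rotation by `2π/Nₙ` about `e₃`, `0 < Nₙ`, and
`Nₙ → ∞`, the sequence is not admissible.  (For `N`-fold wave patterns: the wave number must stay
bounded along the ladder.)
[cite: KochNadirashviliSereginSverak2009, Thm. 5.3 and §6 (axisymmetric Type-I Liouville); Lemma 6.1 (limits of rescaled solutions)] -/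
theorem no_windowSequence_cyclicSymmetric_unboundedOrder (hcmin : 1 < cmin) (hδ : 0 < δ)
    (hε : Tendsto ε atTop (𝓝 0))
    (hW : ∀ n, IsWindowProfile (L n) C₀ cmin cmax δ (ε n) (c n) (R n) (u n) (p n) (d n))
    (A : ℕ → (EuclideanSpace ℝ (Fin 3) ≃ₗᵢ[ℝ] EuclideanSpace ℝ (Fin 3))) (N : ℕ → ℕ)
    (hN0 : ∀ n, 0 < N n) (hN : Tendsto N atTop atTop)
    (hinv : ∀ n, ∀ t < 0, ∀ x,
      (A n).symm (u n t (A n (rotZ (2 * Real.pi / N n) x))) =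
        rotZ (2 * Real.pi / N n) ((A n).symm (u n t (A n x)))) :
    False := by
  refine no_windowSequence_rotInvariant_vanishingAngle hcmin hδ hε hW A
    (fun n => 2 * Real.pi / N n) ?_ (fun n => ?_) hinv
  · exact (tendsto_const_div_atTop_nhds_zero_nat (2 * Real.pi)).comp hN
  · exact div_ne_zero (mul_ne_zero two_ne_zero Real.pi_ne_zero)
      (Nat.cast_ne_zero.2 (hN0 n).ne')

/-- **K1 ∧ (K2 supplied by `C_{N_L}`-symmetric profiles with `N_L → ∞`) is contradictory** — the
supply read along the cofinal singular rungs as ONE sequence. -/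
theorem no_windowSequence_vanishingAngle_census (hcmin : 1 < cmin) (hδ : 0 < δ)
    (hε : Tendsto ε atTop (𝓝 0))
    (hW : ∀ n, IsWindowProfile (L n) C₀ cmin cmax δ (ε n) (c n) (R n) (u n) (p n) (d n)) :
    ¬ (∃ (A : ℕ → (EuclideanSpace ℝ (Fin 3) ≃ₗᵢ[ℝ] EuclideanSpace ℝ (Fin 3))) (α : ℕ → ℝ),
        Tendsto α atTop (𝓝 0) ∧ (∀ n, α n ≠ 0) ∧ ∀ n, ∀ t < 0, ∀ x,
          (A n).symm (u n t (A n (rotZ (α n) x))) = rotZ (α n) ((A n).symm (u n t (A n x)))) :=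
  fun ⟨A, α, hα, hα0, hinv⟩ =>
    no_windowSequence_rotInvariant_vanishingAngle hcmin hδ hε hW A α hα hα0 hinv

end Summit.NavierStokesRegularity.AngularGalerkinLadderVanishingAngleSymmetryExcluded
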